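import Literature.Topology.FourManifolds.CodimTwoNormalEuler
import Summits.SmoothPoincare4.SmoothPoincare4.Theorems.SymplecticOrigamiGromovRecognitionRelEndHelperTransportSection
import Mathlib.Topology.UnitInterval

/-!
# A plane field over a closed disc has a nowhere-zero section
(registered helper `helper_sectionOverDisc` of the stub `stub_normalWitnessTransfer`, line
`cross-cap-laurent`, crux `GromovRecognitionRelEnd`, item stmt-SmoothPoincare4-11009)

Setting: a real normed space `F`, a field of idempotents `P z : F →L[ℝ] F` continuous on the
closed disc `‖z‖ ≤ R` of `ℂ` (`0 < R`), idempotent there, and a nonzero vector `v₀` fixed by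
`P 0`.  Claim (`helper_sectionOverDisc`): there is `t : ℂ → F`, continuous on the closed disc,
with `P z (t z) = t z ≠ 0` for every `z` in the closed disc.

Proof (radial transport from the centre): on the compact metric space
`Y := Metric.closedBall (0 : ℂ) R` put `H y s := P (s • y)` (`s ∈ [0, 1]`; the ray from the
centre to `y` stays in the closed disc).  `H` is jointly continuous, idempotent, and
`H y 0 = P 0` fixes `v₀`, so the discrete parallel transport
`Literature.Topology.FourManifolds.NormalEuler.exists_continuous_section` (the elementary
replacement, in R. C. Kirby's proof of *The Topology of 4-Manifolds*, LNM 1374 (1989), Ch. VIII,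
Thm. 2, pp. 44–45, of "a bundle over a contractible base is trivial") yields a continuous
nowhere-zero `σ : Y → F` with `σ y` fixed by `H y 1 = P y`; extending `σ` by `0` off the disc
gives `t`.

Reference: R. C. Kirby, *The Topology of 4-Manifolds*, LNM 1374, Springer (1989), Ch. VIII,
Thm. 2, pp. 44–45 [Kirby1989].  No new definitions.
-/

noncomputable section

open Set Function Metric
open scoped Topology

-- the prescribed namespace `Summit.<P>.<Sub>.…` duplicates `SmoothPoincare4` (P = Sub)
set_option linter.dupNamespace false

namespace Summit.SmoothPoincare4.SmoothPoincare4.Theorems.GromovRecognitionRelEnd.CrossCapLaurent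

open Literature.Topology.FourManifolds.NormalEuler in
/-- **Registered helper `helper_sectionOverDisc`: a plane field over a closed disc has a
nowhere-zero section.**
Let `P z` (`‖z‖ ≤ R` in `ℂ`, `0 < R`) be a field of idempotents of a real normed space `F`,
continuous and idempotent on the closed disc, and let `v₀ ≠ 0` be fixed by `P 0`. Then there is
`t : ℂ → F`, continuous on the closed disc, with `P z (t z) = t z ≠ 0` on the closed disc: radial
transport of `v₀` from the centre, i.e. `NormalEuler.exists_continuous_section` applied to the
family `H y s := P (s • y)` over the compact closed disc, then extension by `0` off the disc.
[cite: Kirby1989, Ch. VIII, Thm. 2, pp. 44–45] -/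
theorem helper_sectionOverDisc : ∀ (F : Type) [NormedAddCommGroup F] [NormedSpace ℝ F] (P : ℂ → F →L[ℝ] F) (R : ℝ) (v₀ : F), 0 < R → ContinuousOn P (Metric.closedBall 0 R) → (∀ z ∈ Metric.closedBall (0 : ℂ) R, ∀ v, P z (P z v) = P z v) → P 0 v₀ = v₀ → v₀ ≠ 0 → ∃ t : ℂ → F, ContinuousOn t (Metric.closedBall 0 R) ∧ ∀ z ∈ Metric.closedBall (0 : ℂ) R, P z (t z) = t z ∧ t z ≠ 0 := by
  intro F _ _ P R v₀ _hR hP hidem h0 hv₀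
  haveI : CompactSpace (closedBall (0 : ℂ) R) :=
    isCompact_iff_compactSpace.1 (isCompact_closedBall 0 R)
  -- the ray from the centre to a point of the closed disc stays inside the closed disc
  have hmem : ∀ (y : closedBall (0 : ℂ) R) (s : unitInterval),
      ((s : ℝ) • (y : ℂ)) ∈ closedBall (0 : ℂ) R := by
    intro y s
    rw [mem_closedBall_zero_iff, norm_smul, Real.norm_eq_abs, abs_of_nonneg s.2.1]
    calc (s : ℝ) * ‖(y : ℂ)‖ ≤ 1 * ‖(y : ℂ)‖ := by gcongr; exact s.2.2
      _ = ‖(y : ℂ)‖ := one_mul _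
      _ ≤ R := mem_closedBall_zero_iff.1 y.2
  -- the radial family of idempotents
  let H : closedBall (0 : ℂ) R → unitInterval → F →L[ℝ] F := fun y s => P ((s : ℝ) • (y : ℂ))
  have hH : Continuous fun p : closedBall (0 : ℂ) R × unitInterval => H p.1 p.2 := by
    have hc : Continuous fun p : closedBall (0 : ℂ) R × unitInterval => (p.2 : ℝ) • (p.1 : ℂ) :=
      (continuous_subtype_val.comp continuous_snd).smul (continuous_subtype_val.comp continuous_fst)
    exact hP.comp_continuous hc fun p => hmem p.1 p.2
  have hHidem : ∀ y s v, H y s (H y s v) = H y s v := fun y s v => hidem _ (hmem y s) v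
  have hH0 : ∀ y, H y 0 v₀ = v₀ := by
    intro y
    show P (((0 : unitInterval) : ℝ) • (y : ℂ)) v₀ = v₀
    rw [Set.Icc.coe_zero, zero_smul]
    exact h0
  obtain ⟨σ, hσc, hσ⟩ := exists_continuous_section H hH hHidem hv₀ hH0
  classical
  refine ⟨fun z => if h : z ∈ closedBall (0 : ℂ) R then σ ⟨z, h⟩ else 0, ?_, ?_⟩
  · rw [continuousOn_iff_continuous_restrict]
    have heq : (closedBall (0 : ℂ) R).restrict
        (fun z => if h : z ∈ closedBall (0 : ℂ) R then σ ⟨z, h⟩ else 0) = σ := by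
      funext y
      rw [Set.restrict_apply, dif_pos y.2]
    rw [heq]
    exact hσc
  · intro z hz
    have h1 := hσ ⟨z, hz⟩
    have hH1 : H ⟨z, hz⟩ 1 = P z := by
      show P (((1 : unitInterval) : ℝ) • z) = P z
      rw [Set.Icc.coe_one, one_smul]
    rw [hH1] at h1
    simp only [dif_pos hz]
    exact h1

end Summit.SmoothPoincare4.SmoothPoincare4.Theorems.GromovRecognitionRelEnd.CrossCapLaurent

end
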